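import Mathlib
import Summits.MatrixMultiplication.MatrixMultiplication.Theorems.SnSubsetDichotomyNoThresholdSubsetTripleLyapunovBandTwo
import Summits.MatrixMultiplication.MatrixMultiplication.Theorems.SnSubsetDichotomyNoThresholdSubsetTripleDyadicPeel

/-!
# The (Q)-lemma, two-process form: a Lyapunov functional `V` restoring against `q` bounds the time-sum of `q`

Line `klr-graded-polynomial-method`, crux `SnSubsetDichotomy.NoThresholdSubsetTriple` (stmt-MatrixMultiplication-8302), lead c7 report §2a.
The (Q) half of the Freedman architecture for J′ in the form the open input (L1*) requires: the drifting functional (`V`, the renormalised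
charge energy) differs from the summed one (`q = sqEnergy`).  Composition of `stub_lyapunov_band_two` (p157657, via Freedman's inequality
`stub_freedman_exp`) and `stub_dyadic_peel` (p151898).
-/

open MeasureTheory ProbabilityTheory
open scoped BigOperators

namespace Summit.MatrixMultiplication.MatrixMultiplication.Theorems

set_option linter.dupNamespace false in
/-- **(Q)-lemma, two-process form.** Let `V, q ≥ 0` be adapted, `V 0 = 0`, with (L1) `μ[V_{t+1} − V_t | ℱ_t] ≤ K − c q_t/√n`,
(L2) `|V_{t+1} − V_t| ≤ b√n`, (L3) `μ[(V_{t+1} − V_t)² | ℱ_t] ≤ C(q_t + 1)`.  Then for `A ≥ max(2K/c, 1)` with `κA√n ≥ log 2`,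
`κ = min(c/(8b), c²/(35C))`: `μ{A·n·√n ≤ Σ_{t<n} q_t} ≤ 2·exp(−κ A √n)`. [Freedman 1975, Thm. 1.6; lead c7 report §2a] -/
theorem selfBounding_timeSum_tail_two {Ω : Type*} {mΩ : MeasurableSpace Ω} {μ : Measure Ω} [IsProbabilityMeasure μ]
    (ℱ : Filtration ℕ mΩ) (V q : ℕ → Ω → ℝ) (n : ℕ) (hn : 1 ≤ n) (K c b C : ℝ) (hc : 0 < c) (hb : 0 < b) (hC : 0 < C)
    (hV_meas : ∀ t, StronglyMeasurable[ℱ t] (V t)) (hq_meas : ∀ t, StronglyMeasurable[ℱ t] (q t))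
    (hV_nonneg : ∀ t ω, 0 ≤ V t ω) (hq_nonneg : ∀ t ω, 0 ≤ q t ω) (hV0 : ∀ ω, V 0 ω = 0)
    (hL1 : ∀ t, μ[fun ω => V (t + 1) ω - V t ω | ℱ t] ≤ᵐ[μ] fun ω => K - c * q t ω / Real.sqrt n)
    (hL2 : ∀ t ω, |V (t + 1) ω - V t ω| ≤ b * Real.sqrt n)
    (hL3 : ∀ t, μ[fun ω => (V (t + 1) ω - V t ω) ^ 2 | ℱ t] ≤ᵐ[μ] fun ω => C * (q t ω + 1))
    (A : ℝ) (hAK : 2 * K / c ≤ A) (hA1 : 1 ≤ A)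
    (hlog : Real.log 2 ≤ min (c / (8 * b)) (c ^ 2 / (35 * C)) * A * Real.sqrt n) :
    μ.real {ω | A * n * Real.sqrt n ≤ ∑ t ∈ Finset.range n, q t ω} ≤
      2 * Real.exp (-(min (c / (8 * b)) (c ^ 2 / (35 * C)) * A * Real.sqrt n)) :=
  stub_dyadic_peel μ (fun ω => ∑ t ∈ Finset.range n, q t ω) n hn K c b C hc hb hC
    (fun L lam _ hlam => stub_lyapunov_band_two ℱ V q n (by omega) K c b C hc.le hb hC.le hV_meas hq_meas hV_nonneg
      hq_nonneg hV0 hL1 hL2 hL3 L lam hlam)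
    A hAK hA1 hlog

end Summit.MatrixMultiplication.MatrixMultiplication.Theorems
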